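/-
Copyright (c) 2026 the pub-hodgecm-mathlib formalisation cell (harness21).  Prover seat hodgecm-mathlib-K2E3-p20 (g0),
Track B «K2-LIT» ∕ h413, line `K2_E3_EllipticInputs`, unit U5Kazhdan, socket #20P (DISC-PL) — MEMO-20P-road §3 S2 «formalDegreeL2»:
Harish-Chandra's Schur orthogonality relations (a) for SQUARE-INTEGRABLE representations (compact centre), and the formal degree of every
`L²` class of `U(Φ₃)(L⁺_v)`.  2026-09-03.
-/
import Summits.HodgeConjecture.HodgeConjecture.Theorems.K2E3FormalDegreeSupercuspidalWellDefined   -- ★ p855232: `formalDegree_eq_of_invariant_forms`, `exists_pullback_form` (generic; brings ★ Schur-sc, ★ E2-5a package)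
import Literature.NumberTheory.Automorphic.SquareIntegrableModCompactCenter                       -- ★ `memLp_matrixCoeff_of_isSquareIntegrableModCenter_map` (L² mod compact centre ⇒ L²(G)); docstring pointer
import HarnessLib

/-!
# K2_E3 road (h413 = stmt-HodgeConjecture-24833), socket #20P «DISC-PL» — S2 «formalDegreeL2»: SCHUR ORTHOGONALITY (a) AND THE FORMAL DEGREE FOR
# SQUARE-INTEGRABLE REPRESENTATIONS (Harish-Chandra 1970, Part I §1 Theorem 1 (a))

Cell `pub/hodgecm-mathlib` (D-0151), Track B, line `Summits/HodgeConjecture/HodgeConjecture/Cruxes/H413/Lines/K2_E3_EllipticInputs.lean`, unit U5Kazhdan,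
socket #20P `sig_K2E3DiscretePlancherelCuspidal` (annex `…Sigs_U5bWildPlancherel.lean` :144; MEMO-20P-road 6ab33264ff32dae1 §3 S2).  Helper file (`--supports
stmt-HodgeConjecture-24833 --as helper`, no socket closed); THEOREMS ONLY (no `def`, no instance, no notation, no named fact, no `sorry`); ★-only imports.

THE POINT.  ★ `Literature/…/SchurOrthogonalitySupercuspidal` proves Harish-Chandra's Theorem 1 (a) — `∫ conj (B b (ρ x a)) · B e (ρ x c) dν = κ · B e b · B a c`,
`κ = (∫ ‖B (ρ x v₀) v₀‖²) ∕ (re B v₀ v₀)²` for every `v₀ ≠ 0` — for SUPERCUSPIDAL `ρ` (compactly supported coefficients).  Print states it for every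
irreducible `π` that is «square-integrable mod `Z`» [HarishChandra1970, Part I §1 p. 4, Theorem 1: «there exists a number `d(π) > 0` … depending only on the
normalization of the Haar measure»], and the socket #20P quantifies the formal degrees over ALL `L²` classes (`St_G(ψ)`, `π²(ξ)` as well as the
supercuspidals).  In the ★ proof supercuspidality enters at ONE point — the integrability of `x ↦ conj (B (ρ x b) a) · B (ρ x e) c` — and everything
after it (the invariant sesquilinear form, ★ `exists_sesqForm_eq_smul`, the inversion symmetry, the identification of `κ`) is formal.  Here that
integrability is taken from SQUARE-INTEGRABILITY ON `G`: «every coefficient `x ↦ B w (ρ x v)` is in `L²(G, ν)`» (`hL2`) — by Hölder `2 + 2`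
(`MemLp.integrable_mul`); for a representation square-integrable modulo a COMPACT centre this is ★ `memLp_matrixCoeff_of_isSquareIntegrableModCenter_map`
(`B w ∈ Ṽ` by ★ `sesqForm_apply_mem_contragredient`).  Positivity `0 < ∫ ‖B (ρ x v₀) v₀‖²` now comes from Haar measures charging open sets (the
integrand is continuous, integrable and `(re B v₀ v₀)² > 0` at `x = 1`) instead of compact support.
* §1 `integrable_conj_sesqForm_mul_of_memLp`, `exists_integral_conj_sesqForm_mul_eq_of_memLp`, `integral_norm_sq_sesqForm_pos_of_memLp`,
  **`integral_conj_sesqForm_mul_eq_of_memLp`** (Thm 1 (a) with `x⁻¹` inside), **`integral_conj_matrixCoeff_mul_matrixCoeff_eq_of_memLp`**,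
  **`integral_norm_sq_matrixCoeff_eq_of_memLp`** (`∫ |B w (ρ x v)|² = κ · re B w w · re B v v`), `formalDegree_eq_of_ne_zero_of_memLp` (the quotient
  `(re B v v)² ∕ ∫ ‖B (ρ x v) v‖²` is vector-free);
* §2 on `U(Φ₃)(L⁺_v)`: **`exists_formalDegree_of_memLp`** — for EVERY class `π`, one `d > 0` with `(re B v₁ v₁)² ∕ ∫ ‖B (r.ρ x v₁) v₁‖² dνQv = d` and
  `f_{r,B,v₁}(1) = d` for every representative `r`, every invariant positive-definite Hermitian `B` with `L²` coefficients and every `v₁ ≠ 0` (★ p855232's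
  form-independence and transport are generic and reused verbatim) — the formal degree of an `L²` class; ★ p855232 §2 is its supercuspidal case.
NOT here: Theorem 1 (b) for `L²` (orthogonality of inequivalent classes), «`L²` ⇒ unitarisable» (existence of `B`), the trace identity.
HONEST LABEL: count-neutral; HC_CM is proved only modulo the 7 printed citations (2 remaining named inputs: hLiu418 = stmt-HodgeConjecture-24832, h413 =
stmt-HodgeConjecture-24833) until rung 0 closes; this `--supports` helper retires nothing by itself.

## References
* [HarishChandra1970] Harish-Chandra (notes by G. van Dijk), *Harmonic Analysis on Reductive p-adic Groups*, LNM 162 (1970), Part I §1 Theorem 1 (a), p. 4.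
* [Rogawski1990] J. D. Rogawski, *Automorphic Representations of Unitary Groups in Three Variables*, Ann. of Math. Stud. 123 (1990), §12.6 p. 187; §12.7 p. 194
  («`d(π)` is the formal degree of `π`», «Formal degrees are positive»).
-/

set_option autoImplicit false
-- the mandated namespace has the single-problem summit's repeated segment (`HodgeConjecture.HodgeConjecture`)
set_option linter.dupNamespace false

noncomputable section

open MeasureTheory NumberField IsDedekindDomain Filter Topology
open scoped ComplexConjugate
open Literature.NumberTheory.Automorphic Literature.NumberTheory.Automorphic.UnitaryGroup Literature.NumberTheory.Rogawski1990

namespace Summit.HodgeConjecture.HodgeConjecture.Cruxes.H413.K2E3SchurOrthogonalitySquareIntegrable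

/-! ## §1 Generic carriers: Theorem 1 (a) for representations with `L²` coefficients -/

section Generic

variable {G V : Type*} [Group G] [TopologicalSpace G] [NonarchimedeanGroup G]
  [LocallyCompactSpace G] [T2Space G] [MeasurableSpace G] [BorelSpace G]
  [AddCommGroup V] [Module ℂ V] {ρ : Representation ℂ G V} {B : V →ₗ⋆[ℂ] V →ₗ[ℂ] ℂ}

omit [TopologicalSpace G] [NonarchimedeanGroup G] [LocallyCompactSpace G] [T2Space G] [BorelSpace G] in
/-- The products `x ↦ conj (B (ρ x b) a) · B (ρ x e) c` of two coefficients are INTEGRABLE when every coefficient `x ↦ B w (ρ x v)` is in `L²(G, ν)`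
(Hölder `2 + 2`; `conj (B (ρ x b) a) = B a (ρ x b)` and `B (ρ x e) c = conj (B c (ρ x e))` by the Hermitian symmetry).  Replaces the compact-support argument
of ★ `IsSupercuspidal.integrable_conj_sesqForm_mul`. [cite: HarishChandra1970, Part I §1 Theorem 1 (a)] -/
theorem integrable_conj_sesqForm_mul_of_memLp (hBsymm : B.IsSymm) (ν : Measure G)
    (hL2 : ∀ w v : V, MemLp (fun x => B w (ρ x v)) 2 ν) (a b c e : V) :
    Integrable (fun x => conj (B (ρ x b) a) * B (ρ x e) c) ν := by
  have h1 : (fun x => conj (B (ρ x b) a) * B (ρ x e) c) = (fun x => B a (ρ x b)) * fun x => conj (B c (ρ x e)) := by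
    funext x
    simp only [Pi.mul_apply]
    rw [hBsymm.eq (ρ x b) a, ← hBsymm.eq c (ρ x e)]
  rw [h1]
  refine (hL2 a b).integrable_mul ((hL2 c e).of_le (Complex.continuous_conj.comp_aestronglyMeasurable (hL2 c e).1)
    (Eventually.of_forall fun x => ?_))
  simp only [Complex.norm_conj, le_refl]

/-- **Schur orthogonality, unnormalised (`L²` coefficients).**  For `ρ` irreducible admissible with `L²` coefficients, `B` a `G`-invariant positive-definite
Hermitian form and `ν` a left Haar measure: for fixed `b, e` there is `c₀ = c₀(b, e)` with `∫ conj (B (ρ x b) a) · B (ρ x e) c dν = c₀ · B a c` for all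
`a, c` (the left side is a `G`-invariant sesquilinear form in `(a, c)`; ★ `exists_sesqForm_eq_smul`).  Verbatim the ★ supercuspidal proof with §1's
integrability. [cite: HarishChandra1970, Part I §1 Theorem 1 (a)] -/
theorem exists_integral_conj_sesqForm_mul_eq_of_memLp [ρ.IsIrreducible] (hadm : ρ.IsAdmissible)
    (hBsymm : B.IsSymm) (hBpos : ∀ v : V, v ≠ 0 → 0 < (B v v).re)
    (hBinv : ∀ (g : G) (v w : V), B (ρ g v) (ρ g w) = B v w) (ν : Measure G) [ν.IsHaarMeasure]
    (hL2 : ∀ w v : V, MemLp (fun x => B w (ρ x v)) 2 ν) (b e : V) :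
    ∃ c₀ : ℂ, ∀ a c : V, ∫ x, conj (B (ρ x b) a) * B (ρ x e) c ∂ν = c₀ * B a c := by
  have hint := integrable_conj_sesqForm_mul_of_memLp (ρ := ρ) hBsymm ν hL2
  let T : V →ₗ⋆[ℂ] V →ₗ[ℂ] ℂ := LinearMap.mk₂'ₛₗ (starRingEnd ℂ) (RingHom.id ℂ)
    (fun a c => ∫ x, conj (B (ρ x b) a) * B (ρ x e) c ∂ν)
    (fun a₁ a₂ c => by
      simp only [map_add, add_mul]
      exact integral_add (hint a₁ b c e) (hint a₂ b c e))
    (fun z a c => by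
      simp only [map_smul, smul_eq_mul, map_mul, mul_assoc]
      exact integral_const_mul _ _)
    (fun a c₁ c₂ => by
      simp only [map_add, mul_add]
      exact integral_add (hint a b c₁ e) (hint a b c₂ e))
    (fun z a c => by
      simp only [map_smul, smul_eq_mul, RingHom.id_apply, mul_left_comm _ z]
      exact integral_const_mul _ _)
  have hT : ∀ (g : G) (a c : V), T (ρ g a) (ρ g c) = T a c := by
    intro g a c
    simp only [T, LinearMap.mk₂'ₛₗ_apply]
    have key : ∀ x, conj (B (ρ x b) (ρ g a)) * B (ρ x e) (ρ g c) =
        (fun y => conj (B (ρ y b) a) * B (ρ y e) c) (g⁻¹ * x) := by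
      intro x
      simp only [map_mul, Module.End.mul_apply]
      rw [← hBinv g⁻¹ (ρ x b) (ρ g a), ← hBinv g⁻¹ (ρ x e) (ρ g c), Representation.inv_self_apply, Representation.inv_self_apply]
    simp_rw [key]
    exact integral_mul_left_eq_self (μ := ν) (fun y => conj (B (ρ y b) a) * B (ρ y e) c) g⁻¹
  obtain ⟨c₀, hc₀⟩ := Representation.exists_sesqForm_eq_smul hadm hBinv (Representation.eq_zero_of_sesqForm_self_eq_zero hBpos) T hT
  exact ⟨c₀, fun a c => by simpa [T] using hc₀ a c⟩

omit [LocallyCompactSpace G] [T2Space G] [BorelSpace G] in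
/-- **Positivity of the formal-degree integral (`L²` coefficients)**: `0 < ∫ ‖B (ρ x v₀) v₀‖² dν` for `v₀ ≠ 0` — the integrand is continuous (smooth
vector), integrable (`L²`), non-negative and `= (re B v₀ v₀)² > 0` at `x = 1`, and a Haar measure charges the open set where it is non-zero.
[cite: HarishChandra1970, Part I §1 Theorem 1 (a)] -/
theorem integral_norm_sq_sesqForm_pos_of_memLp (hsm : ρ.IsSmooth) (hBsymm : B.IsSymm)
    (hBpos : ∀ v : V, v ≠ 0 → 0 < (B v v).re) (ν : Measure G) [ν.IsHaarMeasure]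
    (hL2 : ∀ w v : V, MemLp (fun x => B w (ρ x v)) 2 ν) {v₀ : V} (hv₀ : v₀ ≠ 0) :
    0 < ∫ x, ‖B (ρ x v₀) v₀‖ ^ 2 ∂ν := by
  have hcont : Continuous fun x => B (ρ x v₀) v₀ := Representation.continuous_sesqForm_apply_apply' hBsymm (hsm v₀) v₀
  have hnorm : (fun x => ‖B (ρ x v₀) v₀‖ ^ 2) = fun x => ‖B v₀ (ρ x v₀)‖ ^ 2 := by
    funext x
    rw [← hBsymm.eq v₀ (ρ x v₀), Complex.norm_conj]
  have hint : Integrable (fun x => ‖B (ρ x v₀) v₀‖ ^ 2) ν := by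
    rw [hnorm]
    exact (memLp_two_iff_integrable_sq_norm (hL2 v₀ v₀).1).1 (hL2 v₀ v₀)
  rw [integral_pos_iff_support_of_nonneg (fun x => sq_nonneg _) hint]
  have hopen : IsOpen (Function.support fun x => ‖B (ρ x v₀) v₀‖ ^ 2) :=
    isOpen_ne_fun ((hcont.norm).pow 2) continuous_const
  have h1 : (1 : G) ∈ Function.support fun x => ‖B (ρ x v₀) v₀‖ ^ 2 := by
    rw [Function.mem_support]
    simp only [map_one, Module.End.one_apply, ne_eq, pow_eq_zero_iff two_ne_zero, norm_eq_zero]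
    intro h0
    exact (hBpos v₀ hv₀).ne' (by rw [h0, Complex.zero_re])
  exact hopen.measure_pos ν ⟨1, h1⟩

/-- **HARISH-CHANDRA'S THEOREM 1 (a) FOR SQUARE-INTEGRABLE REPRESENTATIONS** (compact-centre form, integrals over `G`).  Let `ρ` be irreducible admissible
with every coefficient `x ↦ B w (ρ x v)` in `L²(G, ν)`, `B` a `G`-invariant positive-definite Hermitian form, `ν` an inversion-invariant Haar measure.
Then for all `a b c e` and every `v₀ ≠ 0`: `∫ conj (B (ρ x b) a) · B (ρ x e) c dν = κ · B e b · B a c`, `κ = (∫ ‖B (ρ x v₀) v₀‖² dν) ∕ (re B v₀ v₀)²`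
— `κ = d(ρ)⁻¹`, INDEPENDENT of `v₀`.  (Verbatim the ★ supercuspidal argument: the unnormalised form, the symmetry `x ↦ x⁻¹` ★
`integral_conj_sesqForm_mul_symm`, and the diagonal value.) [cite: HarishChandra1970, Part I §1 Theorem 1 (a)] -/
theorem integral_conj_sesqForm_mul_eq_of_memLp [ρ.IsIrreducible] (hadm : ρ.IsAdmissible) (hBsymm : B.IsSymm)
    (hBpos : ∀ v : V, v ≠ 0 → 0 < (B v v).re)
    (hBinv : ∀ (g : G) (v w : V), B (ρ g v) (ρ g w) = B v w) (ν : Measure G) [ν.IsHaarMeasure] [ν.IsInvInvariant]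
    (hL2 : ∀ w v : V, MemLp (fun x => B w (ρ x v)) 2 ν) {v₀ : V} (hv₀ : v₀ ≠ 0) (a b c e : V) :
    ∫ x, conj (B (ρ x b) a) * B (ρ x e) c ∂ν =
      (((∫ x, ‖B (ρ x v₀) v₀‖ ^ 2 ∂ν) / (B v₀ v₀).re ^ 2 : ℝ) : ℂ) * (B e b * B a c) := by
  choose Λ hΛ using exists_integral_conj_sesqForm_mul_eq_of_memLp (ρ := ρ) hadm hBsymm hBpos hBinv ν hL2
  have hsymm := Representation.integral_conj_sesqForm_mul_symm (ρ := ρ) hBsymm hBinv ν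
  -- `Λ b e · B a c = conj (Λ a c) · B e b`
  have hrel : ∀ a b c e : V, Λ b e * B a c = conj (Λ a c) * B e b := by
    intro a b c e
    rw [← hΛ, hsymm, hΛ, map_mul, hBsymm.eq]
  set β : ℂ := B v₀ v₀ with hβ
  have hβre : (β.re : ℂ) = β := Complex.conj_eq_iff_re.1 (hBsymm.eq v₀ v₀)
  have hβ0 : β ≠ 0 := fun h0 => hv₀ (Representation.eq_zero_of_sesqForm_self_eq_zero hBpos v₀ h0)
  have hβre0 : β.re ≠ 0 := (hBpos v₀ hv₀).ne'
  -- `Λ₀ := Λ v₀ v₀` is real and `Λ b e = Λ₀ / β · B e b`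
  have hΛ₀ : conj (Λ v₀ v₀) = Λ v₀ v₀ := by
    have h := hrel v₀ v₀ v₀ v₀
    rw [← hβ] at h
    exact (mul_right_cancel₀ hβ0 h).symm
  have hΛbe : Λ b e * β = Λ v₀ v₀ * B e b := by
    have h := hrel v₀ b v₀ e
    rwa [← hβ, hΛ₀] at h
  -- the diagonal value `Λ₀ β = ∫ ‖B (ρ x v₀) v₀‖²`
  have hdiag : Λ v₀ v₀ * β = ((∫ x, ‖B (ρ x v₀) v₀‖ ^ 2 ∂ν : ℝ) : ℂ) := by
    rw [hβ, ← hΛ, ← integral_complex_ofReal]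
    refine integral_congr_ae (Filter.Eventually.of_forall fun x => ?_)
    simp only [Complex.conj_mul', Complex.ofReal_pow]
  -- assemble
  rw [hΛ]
  have hΛbe' : Λ b e = Λ v₀ v₀ * B e b / β := by
    rw [eq_div_iff hβ0, hΛbe]
  have hΛ₀' : Λ v₀ v₀ = ((∫ x, ‖B (ρ x v₀) v₀‖ ^ 2 ∂ν : ℝ) : ℂ) / β := by
    rw [eq_div_iff hβ0, hdiag]
  rw [hΛbe', hΛ₀', Complex.ofReal_div, Complex.ofReal_pow, hβre]
  field_simp

/-- **Theorem 1 (a), matrix-coefficient form (`L²` coefficients)**: with `c_{w,v}(x) := B w (ρ x v)`,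
`∫ conj (c_{b,a}(x)) · c_{e,c}(x) dν(x) = κ · B e b · B a c`, `κ = (∫ ‖B (ρ x v₀) v₀‖² dν) ∕ (re B v₀ v₀)²` for every `v₀ ≠ 0`. [cite: HarishChandra1970, Part I §1 Theorem 1 (a)] -/
theorem integral_conj_matrixCoeff_mul_matrixCoeff_eq_of_memLp [ρ.IsIrreducible] (hadm : ρ.IsAdmissible) (hBsymm : B.IsSymm)
    (hBpos : ∀ v : V, v ≠ 0 → 0 < (B v v).re)
    (hBinv : ∀ (g : G) (v w : V), B (ρ g v) (ρ g w) = B v w) (ν : Measure G) [ν.IsHaarMeasure] [ν.IsInvInvariant]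
    (hL2 : ∀ w v : V, MemLp (fun x => B w (ρ x v)) 2 ν) {v₀ : V} (hv₀ : v₀ ≠ 0) (a b c e : V) :
    ∫ x, conj (B b (ρ x a)) * B e (ρ x c) ∂ν =
      (((∫ x, ‖B (ρ x v₀) v₀‖ ^ 2 ∂ν) / (B v₀ v₀).re ^ 2 : ℝ) : ℂ) * (B e b * B a c) := by
  rw [← integral_conj_sesqForm_mul_eq_of_memLp hadm hBsymm hBpos hBinv ν hL2 hv₀ a b c e,
    ← integral_inv_eq_self (fun x => conj (B (ρ x b) a) * B (ρ x e) c) ν]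
  refine integral_congr_ae (Filter.Eventually.of_forall fun x => ?_)
  simp only
  rw [← hBinv x (ρ x⁻¹ b) a, ← hBinv x (ρ x⁻¹ e) c, Representation.self_inv_apply, Representation.self_inv_apply]

/-- **Theorem 1 (a), norm form (`L²` coefficients)**: `∫ |B w (ρ x v)|² dν = κ · re B w w · re B v v` — Harish-Chandra's `∫ |(φ, π(x)ψ)|² dx =
d(π)⁻¹ ‖φ‖² ‖ψ‖²`, the definition of the FORMAL DEGREE `d(ρ) = κ⁻¹` of a square-integrable `ρ` relative to `ν`. [cite: HarishChandra1970, Part I §1 Theorem 1 (a)] -/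
theorem integral_norm_sq_matrixCoeff_eq_of_memLp [ρ.IsIrreducible] (hadm : ρ.IsAdmissible) (hBsymm : B.IsSymm)
    (hBpos : ∀ v : V, v ≠ 0 → 0 < (B v v).re)
    (hBinv : ∀ (g : G) (v w : V), B (ρ g v) (ρ g w) = B v w) (ν : Measure G) [ν.IsHaarMeasure] [ν.IsInvInvariant]
    (hL2 : ∀ w v : V, MemLp (fun x => B w (ρ x v)) 2 ν) {v₀ : V} (hv₀ : v₀ ≠ 0) (v w : V) :
    ∫ x, ‖B w (ρ x v)‖ ^ 2 ∂ν =
      (∫ x, ‖B (ρ x v₀) v₀‖ ^ 2 ∂ν) / (B v₀ v₀).re ^ 2 * ((B w w).re * (B v v).re) := by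
  have h := integral_conj_matrixCoeff_mul_matrixCoeff_eq_of_memLp hadm hBsymm hBpos hBinv ν hL2 hv₀ v w v w
  have hw : (B w w : ℂ) = ((B w w).re : ℂ) := (Complex.conj_eq_iff_re.1 (hBsymm.eq w w)).symm
  have hv : (B v v : ℂ) = ((B v v).re : ℂ) := (Complex.conj_eq_iff_re.1 (hBsymm.eq v v)).symm
  have hl : ∫ x, conj (B w (ρ x v)) * B w (ρ x v) ∂ν = ((∫ x, ‖B w (ρ x v)‖ ^ 2 ∂ν : ℝ) : ℂ) := by
    rw [← integral_complex_ofReal]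
    refine integral_congr_ae (Filter.Eventually.of_forall fun x => ?_)
    simp only [Complex.conj_mul', Complex.ofReal_pow]
  rw [hl, hw, hv] at h
  exact_mod_cast h

/-- **Independence of the vector (`L²` coefficients).**  The quotient `(re B v v)² ∕ ∫ ‖B (ρ x v) v‖² dν` — the formal degree read off the diagonal
coefficient of `v` — is the same for all `v ≠ 0`. [cite: HarishChandra1970, Part I §1 Theorem 1 (a)] -/
theorem formalDegree_eq_of_ne_zero_of_memLp [ρ.IsIrreducible] (hadm : ρ.IsAdmissible) (hBsymm : B.IsSymm)
    (hBpos : ∀ v : V, v ≠ 0 → 0 < (B v v).re)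
    (hBinv : ∀ (g : G) (v w : V), B (ρ g v) (ρ g w) = B v w) (ν : Measure G) [ν.IsHaarMeasure] [ν.IsInvInvariant]
    (hL2 : ∀ w v : V, MemLp (fun x => B w (ρ x v)) 2 ν) {v w : V} (hv : v ≠ 0) (hw : w ≠ 0) :
    (B v v).re ^ 2 / ∫ x, ‖B (ρ x v) v‖ ^ 2 ∂ν = (B w w).re ^ 2 / ∫ x, ‖B (ρ x w) w‖ ^ 2 ∂ν := by
  have h := integral_norm_sq_matrixCoeff_eq_of_memLp hadm hBsymm hBpos hBinv ν hL2 hw v v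
  have hsw : (fun x => ‖B v (ρ x v)‖ ^ 2) = fun x => ‖B (ρ x v) v‖ ^ 2 := by
    funext x
    rw [← hBsymm.eq (ρ x v) v, Complex.norm_conj]
  rw [hsw] at h
  have hIw : 0 < ∫ x, ‖B (ρ x w) w‖ ^ 2 ∂ν := integral_norm_sq_sesqForm_pos_of_memLp hadm.isSmooth hBsymm hBpos ν hL2 hw
  have ha : 0 < (B v v).re := hBpos v hv
  have hb : 0 < (B w w).re := hBpos w hw
  rw [h]
  field_simp

end Generic

/-! ## §2 `U(Φ₃)(L⁺_v)`: the formal degree of a class with an `L²` datum -/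

section CM

variable (L : Type) [Field L] [NumberField L] [IsCMField L] (v : HeightOneSpectrum (𝓞 ↥(maximalRealSubfield L)))

set_option maxHeartbeats 1600000 in
/-- **THE FORMAL DEGREE OF A SQUARE-INTEGRABLE CLASS (relative to `νQv`) IS WELL DEFINED.**  On `G = U(Φ₃)(L⁺_v)`, `v` non-split (every irreducible
smooth representation admissible ★, `νQv` inversion-invariant ★), for EVERY class `π` there is ONE real `d > 0` such that for every representative `r` of
`π`, every invariant positive-definite Hermitian form `B` on `r.V` whose coefficients `x ↦ B w (r.ρ x v)` are all in `L²(G, νQv)`, and every `v₁ ≠ 0`: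
`(re B v₁ v₁)² ∕ ∫ ‖B (r.ρ x v₁) v₁‖² dνQv = d` and `f_{r,B,v₁}(1) = d` for the normalised coefficient `f_{r,B,v₁} = ((∫ ‖B (r.ρ x v₁) v₁‖²) ∕ re B v₁ v₁)⁻¹ •
(g ↦ B (r.ρ g v₁) v₁)` — Harish-Chandra's `d(π)` for the discrete series (for classes WITHOUT such an `L²` datum the statement is vacuous).  PROOF: if a
datum `(r₀, B₀, v₀)` exists, `d :=` its quotient; any other `(r, B, v₁)` of the class: `φ : r.ρ ≃ r₀.ρ`, pull `B₀` back along `φ` (★ `exists_pullback_form`;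
the pulled-back coefficients are coefficients of `B₀`, hence `L²`), then §1's vector independence in `r₀` and ★ `formalDegree_eq_of_invariant_forms` in `r`.
[cite: HarishChandra1970, Part I §1 Theorem 1 (a)] [cite: Rogawski1990, §12.7 p. 194] -/
theorem exists_formalDegree_of_memLp
    (hns : ∀ w : PlacesOver L v, IsCMField.complexConj L • w.1 = w.1)
    [MeasurableSpace (Gqs L v)] [BorelSpace (Gqs L v)] (νQv : Measure (Gqs L v)) [νQv.IsHaarMeasure]
    (π : IrrClass (Gqs L v)) :
    ∃ d : ℝ, 0 < d ∧ ∀ (r : SmoothIrrep (Gqs L v)), IrrClass.mk r = π →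
      ∀ (B : r.V →ₗ⋆[ℂ] r.V →ₗ[ℂ] ℂ), B.IsSymm → (∀ w : r.V, w ≠ 0 → 0 < (B w w).re) →
        (∀ (g : Gqs L v) (w w' : r.V), B (r.ρ g w) (r.ρ g w') = B w w') →
        (∀ w w' : r.V, MemLp (fun x => B w (r.ρ x w')) 2 νQv) →
        ∀ v₁ : r.V, v₁ ≠ 0 →
          (B v₁ v₁).re ^ 2 / ∫ x, ‖B (r.ρ x v₁) v₁‖ ^ 2 ∂νQv = d ∧
          ((((∫ x, ‖B (r.ρ x v₁) v₁‖ ^ 2 ∂νQv) / (B v₁ v₁).re : ℝ) : ℂ)⁻¹ • fun g => B (r.ρ g v₁) v₁) 1 = (d : ℂ) := by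
  classical
  haveI : NonarchimedeanGroup (Gqs L v) := F0P3cStCharTSScTracePackage.nonarchimedeanGroup_Gqs L v
  haveI : νQv.IsInvInvariant := F0P3cStCharTSScTracePackage.isInvInvariant_haar_Gqs L v νQv
  -- the value at `1` of the normalised coefficient is the quotient (pure algebra, for any datum with `re B v₁ v₁ ≠ 0`)
  have hval1 : ∀ (r : SmoothIrrep (Gqs L v)) (B : r.V →ₗ⋆[ℂ] r.V →ₗ[ℂ] ℂ), B.IsSymm → (∀ w : r.V, w ≠ 0 → 0 < (B w w).re) →
      ∀ v₁ : r.V, v₁ ≠ 0 →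
      ((((∫ x, ‖B (r.ρ x v₁) v₁‖ ^ 2 ∂νQv) / (B v₁ v₁).re : ℝ) : ℂ)⁻¹ • fun g => B (r.ρ g v₁) v₁) 1 =
        (((B v₁ v₁).re ^ 2 / ∫ x, ‖B (r.ρ x v₁) v₁‖ ^ 2 ∂νQv : ℝ) : ℂ) := by
    intro r B hBsymm hBpos v₁ hv₁
    simp only [Pi.smul_apply, smul_eq_mul, map_one, Module.End.one_apply]
    set a : ℝ := (B v₁ v₁).re with ha
    have hβ : (B v₁ v₁ : ℂ) = (a : ℂ) := (Complex.conj_eq_iff_re.1 (hBsymm.eq v₁ v₁)).symm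
    have ha0 : (a : ℂ) ≠ 0 := by exact_mod_cast (hBpos v₁ hv₁).ne'
    rw [hβ]
    by_cases hI : (∫ x, ‖B (r.ρ x v₁) v₁‖ ^ 2 ∂νQv) = 0
    · rw [hI]; simp
    · have hI' : ((∫ x, ‖B (r.ρ x v₁) v₁‖ ^ 2 ∂νQv : ℝ) : ℂ) ≠ 0 := by exact_mod_cast hI
      push_cast
      field_simp
  by_cases hex : ∃ (r₀ : SmoothIrrep (Gqs L v)) (_ : IrrClass.mk r₀ = π) (B₀ : r₀.V →ₗ⋆[ℂ] r₀.V →ₗ[ℂ] ℂ) (_ : B₀.IsSymm)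
      (_ : ∀ w : r₀.V, w ≠ 0 → 0 < (B₀ w w).re) (_ : ∀ (g : Gqs L v) (w w' : r₀.V), B₀ (r₀.ρ g w) (r₀.ρ g w') = B₀ w w')
      (_ : ∀ w w' : r₀.V, MemLp (fun x => B₀ w (r₀.ρ x w')) 2 νQv) (v₀ : r₀.V), v₀ ≠ 0
  · obtain ⟨r₀, hr₀, B₀, hB₀symm, hB₀pos, hB₀inv, hB₀L2, v₀, hv₀⟩ := hex
    haveI : r₀.ρ.IsIrreducible := r₀.isIrreducible
    have hadm₀ : r₀.ρ.IsAdmissible := F0P3cStCharTSScTracePackage.isAdmissible_smoothIrrep L v hns r₀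
    refine ⟨(B₀ v₀ v₀).re ^ 2 / ∫ x, ‖B₀ (r₀.ρ x v₀) v₀‖ ^ 2 ∂νQv,
      div_pos (pow_pos (hB₀pos v₀ hv₀) 2) (integral_norm_sq_sesqForm_pos_of_memLp hadm₀.isSmooth hB₀symm hB₀pos νQv hB₀L2 hv₀), ?_⟩
    intro r hr B hBsymm hBpos hBinv hBL2 v₁ hv₁
    haveI : r.ρ.IsIrreducible := r.isIrreducible
    have hadm : r.ρ.IsAdmissible := F0P3cStCharTSScTracePackage.isAdmissible_smoothIrrep L v hns r
    -- `φ : r.ρ ≃ r₀.ρ`, the pulled-back form `P = φ^* B₀` on `r.V` (its coefficients are coefficients of `B₀`, hence `L²`)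
    obtain ⟨φ⟩ := (IrrClass.mk_eq_mk_iff r r₀).1 (hr.trans hr₀.symm)
    obtain ⟨P, hPapply, hPsymm, hPpos, hPinv, hPcoeff⟩ :=
      K2E3FormalDegreeSupercuspidalWellDefined.exists_pullback_form φ hB₀symm hB₀pos hB₀inv
    have hφ : ∀ (g : Gqs L v) (w : r.V), φ (r.ρ g w) = r₀.ρ g (φ w) := fun g w => by
      rw [← Representation.Equiv.coe_toIntertwiningMap]
      exact φ.toIntertwiningMap.isIntertwining r.ρ r₀.ρ g w
    have hPL2 : ∀ w w' : r.V, MemLp (fun x => P w (r.ρ x w')) 2 νQv := by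
      intro w w'
      have h : (fun x => P w (r.ρ x w')) = fun x => B₀ (φ w) (r₀.ρ x (φ w')) := by
        funext x; rw [hPapply, hφ]
      rw [h]; exact hB₀L2 (φ w) (φ w')
    have hφv₁ : φ v₁ ≠ 0 := fun h => hv₁ (by simpa using congrArg φ.symm h)
    -- the chain: (B, v₁) = (P, v₁) [form] = (B₀, φ v₁) [transport] = (B₀, v₀) [vector]
    have h1 : (B v₁ v₁).re ^ 2 / ∫ x, ‖B (r.ρ x v₁) v₁‖ ^ 2 ∂νQv = (P v₁ v₁).re ^ 2 / ∫ x, ‖P (r.ρ x v₁) v₁‖ ^ 2 ∂νQv :=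
      K2E3FormalDegreeSupercuspidalWellDefined.formalDegree_eq_of_invariant_forms hadm hBsymm hBpos hBinv hPsymm hPpos hPinv νQv hv₁
    have h2 : (P v₁ v₁).re ^ 2 / ∫ x, ‖P (r.ρ x v₁) v₁‖ ^ 2 ∂νQv =
        (B₀ (φ v₁) (φ v₁)).re ^ 2 / ∫ x, ‖B₀ (r₀.ρ x (φ v₁)) (φ v₁)‖ ^ 2 ∂νQv := by
      rw [hPapply]
      simp_rw [hPcoeff]
    have h3 : (B₀ (φ v₁) (φ v₁)).re ^ 2 / ∫ x, ‖B₀ (r₀.ρ x (φ v₁)) (φ v₁)‖ ^ 2 ∂νQv =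
        (B₀ v₀ v₀).re ^ 2 / ∫ x, ‖B₀ (r₀.ρ x v₀) v₀‖ ^ 2 ∂νQv :=
      formalDegree_eq_of_ne_zero_of_memLp hadm₀ hB₀symm hB₀pos hB₀inv νQv hB₀L2 hφv₁ hv₀
    have hval : (B v₁ v₁).re ^ 2 / ∫ x, ‖B (r.ρ x v₁) v₁‖ ^ 2 ∂νQv = (B₀ v₀ v₀).re ^ 2 / ∫ x, ‖B₀ (r₀.ρ x v₀) v₀‖ ^ 2 ∂νQv := by
      rw [h1, h2, h3]
    refine ⟨hval, ?_⟩
    rw [hval1 r B hBsymm hBpos v₁ hv₁, hval]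
  · -- no `L²` datum in the class: vacuous
    refine ⟨1, one_pos, ?_⟩
    intro r hr B hBsymm hBpos hBinv hBL2 v₁ hv₁
    exact (hex ⟨r, hr, B, hBsymm, hBpos, hBinv, hBL2, v₁, hv₁⟩).elim

end CM

end Summit.HodgeConjecture.HodgeConjecture.Cruxes.H413.K2E3SchurOrthogonalitySquareIntegrable

end
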